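import Summits.NavierStokesRegularity.NavierStokesRegularity.Theses.AxisymmetricExtremality
import Summits.NavierStokesRegularity.NavierStokesRegularity.Theorems.AxisymmetricExtremalityAxisymmetricKatoGlobalStubSeregin2020TypeIIAncientLimit
import Literature.Analysis.FluidPDE.Seregin2020AncientLimitSymmetry
import HarnessLib

/-!
# Seregin 2020, proof of Thm 2.1, (2.8): the swirl bound `Γ = ϱ u_φ ∈ L_∞(Q₋)` of the blow-up
# limit from the local bound (2.6) of the swirl of the original solution

Helper toward the stub `stub_seregin2020TypeII` of the crux `AxisymmetricKatoGlobal` (= the named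
fact `Literature.Analysis.FluidPDE.Seregin2020_axisymmetricSingularPoint_typeII`, G. Seregin,
Anal. Math. Phys. 10 (2020) Paper 46 = arXiv:2006.04140, Thm 2.1). After the Moser bound (2.6)
`sup_{z ∈ Q(1/2)} |σ(z)| = sup |x'| |v_φ(z)| ≤ c(M)` for the swirl `σ = ϱ v_φ = x₁v₂ - x₂v₁` of the
original solution, the printed proof rescales at the origin, `uᵏ(y, s) = λₖ v(λₖ y, λₖ² s)`, and
records about the limit `u` (arXiv p. 7): "In addition, as it follows from (2.6),
`Γ = ϱ u_φ ∈ L_∞(Q₋)`" ((2.8)). The two facts behind this sentence are proved here: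

* the swirl is INVARIANT under the Navier–Stokes scaling centred on the axis,
  `swirl (λ v(λ² s, λ ·)) (y) = swirl (v(λ² s)) (λ y)` (`swirl_nsZoom`), so an essential bound
  `|σ| ≤ c` on `Q(1/2)` is an essential bound `|swirl uᵏ| ≤ c` on `Q(a)` as soon as `λₖ a ≤ 1/2`
  (`ae_abs_swirl_zoom_le`);
* essential bounds of the swirl pass to strong `L³` limits (`ae_abs_swirl_le_of_tendsto_eLpNorm`:
  a subsequence converges a.e., `TendstoInMeasure.exists_seq_tendsto_ae`).

Hence (`ancientLimit_abs_swirl_le`) the limit `w` of the rescaled velocities satisfies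
`|swirl (w s)| ≤ c` a.e. on every `Q(a)`; and (`exists_ancientLimit_isAxisymmetric_swirl_le`) the
blow-up limit of `exists_ancientLimit_isAxisymmetric` has, in addition to properties (𝒜) and
(2.9), a bounded swirl ((2.8)) — GIVEN the bound (2.6) for the original solution, which is taken
here as an explicit hypothesis (its proof, the Moser iteration (2.2)–(2.6), is the open part of the
in-tree discharge; see `Seregin2020SwirlMoser*.lean`).

## References

* G. Seregin, Anal. Math. Phys. 10 (2020), Paper 46 = arXiv:2006.04140, proof of Thm. 2.1, (2.6)
  and (2.8). [Seregin2020]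
-/

-- the problem directory repeats the summit name (D-0017); core's `dupNamespace` linter fires
set_option linter.dupNamespace false

noncomputable section

open MeasureTheory Set Function Filter Topology TopologicalSpace Metric
open scoped NNReal ENNReal

namespace Summit.NavierStokesRegularity.NavierStokesRegularity.Theorems.AxisymmetricKatoGlobal.EulerScaling

open Literature.Analysis.FluidPDE Literature.Analysis.FluidPDE.Seregin2020

/-! ### Scale invariance of the swirl -/

/-- **The swirl is invariant under the Navier–Stokes scaling about the axis**:
`swirl (λ v(λ² s, λ ·)) y = swirl (v (λ² s)) (λ y)` (`σ = x₁v₂ - x₂v₁` has scaling dimension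
zero). [cite: Seregin2020, proof of Thm 2.1, (2.8) from (2.6)] -/
theorem swirl_nsZoom (v : ℝ → EuclideanSpace ℝ (Fin 3) → EuclideanSpace ℝ (Fin 3)) (lam s : ℝ)
    (y : EuclideanSpace ℝ (Fin 3)) :
    swirl ((lam • stPull (lam ^ 2) lam (0 : ℝ) (0 : EuclideanSpace ℝ (Fin 3)) v) s) y =
      swirl (v (lam ^ 2 * s)) (lam • y) := by
  simp only [swirl, Pi.smul_apply, stPull_apply, zero_add, PiLp.smul_apply, smul_eq_mul]
  ring

/-- The essential bound `|σ| ≤ c` on `Q(1/2)` of the swirl of `v` is an essential bound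
`|swirl uᵏ| ≤ c` on `Q(a)` for the rescaled field `uᵏ = λ v(λ² s, λ y)` once `a λ ≤ 1/2`
(`Φ_λ(Q(a)) = Q(aλ) ⊆ Q(1/2)`, and `Φ_λ` is non-singular for Lebesgue measure).
[cite: Seregin2020, proof of Thm 2.1, (2.8) from (2.6)] -/
theorem ae_abs_swirl_zoom_le {v : ℝ → EuclideanSpace ℝ (Fin 3) → EuclideanSpace ℝ (Fin 3)} {c : ℝ}
    (hσ : ∀ᵐ z ∂(volume.restrict (parabolicCylinder (1 / 2) (0 : ℝ × EuclideanSpace ℝ (Fin 3)))),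
      |swirl (v z.1) z.2| ≤ c)
    {lam a : ℝ} (hlam : 0 < lam) (ha : 0 < a) (halam : a * lam ≤ 1 / 2) :
    ∀ᵐ z ∂(volume.restrict (parabolicCylinder a (0 : ℝ × EuclideanSpace ℝ (Fin 3)))),
      |swirl ((lam • stPull (lam ^ 2) lam (0 : ℝ) (0 : EuclideanSpace ℝ (Fin 3)) v) z.1) z.2| ≤ c := by
  -- the bound on `Q(aλ) ⊆ Q(1/2)`
  have hσ' : ∀ᵐ z ∂(volume.restrict (parabolicCylinder (a * lam) (0 : ℝ × EuclideanSpace ℝ (Fin 3)))),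
      |swirl (v z.1) z.2| ≤ c :=
    ae_restrict_of_ae_restrict_of_subset (parabolicCylinder_mono (by positivity) halam _) hσ
  -- pulled back along `Φ_λ (s, y) = (λ² s, λ y)`
  have hpre : stAffine (lam ^ 2) lam (0 : ℝ) (0 : EuclideanSpace ℝ (Fin 3)) ⁻¹'
      parabolicCylinder (a * lam) (0 : ℝ × EuclideanSpace ℝ (Fin 3)) =
      parabolicCylinder a (0 : ℝ × EuclideanSpace ℝ (Fin 3)) := by
    have h := zoom_preimage_parabolicCylinder hlam (0 : ℝ × EuclideanSpace ℝ (Fin 3)) (a * lam)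
    rw [mul_div_cancel_right₀ a hlam.ne'] at h
    simpa only [Prod.fst_zero, Prod.snd_zero] using h
  have hqmp : Measure.QuasiMeasurePreserving
      (stAffine (lam ^ 2) lam (0 : ℝ) (0 : EuclideanSpace ℝ (Fin 3)))
      (volume.restrict (parabolicCylinder a (0 : ℝ × EuclideanSpace ℝ (Fin 3))))
      (volume.restrict (parabolicCylinder (a * lam) (0 : ℝ × EuclideanSpace ℝ (Fin 3)))) := by
    refine ⟨measurable_stAffine _ _ _ _, ?_⟩
    rw [← hpre, map_stAffine_volume_restrict_preimage (pow_pos hlam 2) hlam]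
    exact Measure.smul_absolutelyContinuous
  filter_upwards [hqmp.ae hσ'] with z hz
  rw [swirl_nsZoom]
  simpa only [stAffine, zero_add] using hz

/-! ### Essential bounds of the swirl pass to strong limits -/

/-- **An essential bound of the swirl passes to strong `L³` limits.** If `V_j → w` in `L³(μ)`
(`μ` Lebesgue measure on `Q(a)`) and `|swirl (V_j s) y| ≤ c` for a.e. `(s, y)` for all large `j`,
then `|swirl (w s) y| ≤ c` a.e.: along a subsequence `V_j → w` a.e., and the swirl
`y₁v₂ - y₂v₁` is continuous in `v`. [folklore] -/
theorem ae_abs_swirl_le_of_tendsto_eLpNorm {a c : ℝ}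
    {V : ℕ → ℝ → EuclideanSpace ℝ (Fin 3) → EuclideanSpace ℝ (Fin 3)}
    {w : ℝ → EuclideanSpace ℝ (Fin 3) → EuclideanSpace ℝ (Fin 3)}
    (hV : ∀ j, AEStronglyMeasurable (uncurry (V j))
      (volume.restrict (parabolicCylinder a (0 : ℝ × EuclideanSpace ℝ (Fin 3)))))
    (hw : AEStronglyMeasurable (uncurry w)
      (volume.restrict (parabolicCylinder a (0 : ℝ × EuclideanSpace ℝ (Fin 3)))))
    (hconv : Tendsto (fun j => eLpNorm (uncurry (V j) - uncurry w) 3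
      (volume.restrict (parabolicCylinder a (0 : ℝ × EuclideanSpace ℝ (Fin 3))))) atTop (𝓝 0))
    (hb : ∀ᶠ j in atTop,
      ∀ᵐ z ∂(volume.restrict (parabolicCylinder a (0 : ℝ × EuclideanSpace ℝ (Fin 3)))),
        |swirl (V j z.1) z.2| ≤ c) :
    ∀ᵐ z ∂(volume.restrict (parabolicCylinder a (0 : ℝ × EuclideanSpace ℝ (Fin 3)))),
      |swirl (w z.1) z.2| ≤ c := by
  set μ : Measure (ℝ × EuclideanSpace ℝ (Fin 3)) :=
    volume.restrict (parabolicCylinder a (0 : ℝ × EuclideanSpace ℝ (Fin 3))) with hμ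
  -- an a.e. convergent subsequence
  have hmeas : TendstoInMeasure μ (fun j => uncurry (V j)) atTop (uncurry w) :=
    tendstoInMeasure_of_tendsto_eLpNorm (by norm_num) hV hw hconv
  obtain ⟨ns, hns, hae⟩ := hmeas.exists_seq_tendsto_ae
  -- the bound along the subsequence, for all large indices at once
  obtain ⟨j₀, hj₀⟩ := eventually_atTop.1 hb
  have hall : ∀ᵐ z ∂μ, ∀ i, j₀ ≤ i → |swirl (V (ns i) z.1) z.2| ≤ c := by
    refine ae_all_iff.2 fun i => ?_
    by_cases hi : j₀ ≤ i
    · filter_upwards [hj₀ (ns i) (hi.trans (hns.id_le i))] with z hz _ using hz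
    · exact ae_of_all _ fun z h => absurd h hi
  filter_upwards [hae, hall] with z hz hzb
  -- continuity of the swirl in the field value
  have hcont : Continuous fun q : EuclideanSpace ℝ (Fin 3) => |z.2 0 * q 1 - z.2 1 * q 0| := by
    fun_prop
  have ht : Tendsto (fun i => |swirl (V (ns i) z.1) z.2|) atTop (𝓝 |swirl (w z.1) z.2|) :=
    (hcont.tendsto (uncurry w z)).comp hz
  exact le_of_tendsto ht (eventually_atTop.2 ⟨j₀, fun i hi => hzb i hi⟩)

/-! ### (2.8) for the blow-up limit -/

/-- **Seregin 2020, (2.8): the swirl of the blow-up limit is bounded**, given the bound (2.6) for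
the original field. Let `v` be a.e. strongly measurable on `Q(1/2)` with `|swirl (v t) x| ≤ c`
for a.e. `(t, x) ∈ Q(1/2)` (the conclusion of the Moser bound (2.6)), let `λⱼ → 0⁺`, and let the
rescaled velocities `λⱼ v(λⱼ² s, λⱼ y)` converge to `w` in `L³(Q(a))`. Then
`|swirl (w s) y| ≤ c` for a.e. `(s, y) ∈ Q(a)`. [cite: Seregin2020, proof of Thm 2.1, (2.8) ("as it follows from (2.6), Γ = ϱu_φ ∈ L_∞(Q₋)")] -/
theorem ancientLimit_abs_swirl_le
    {v : ℝ → EuclideanSpace ℝ (Fin 3) → EuclideanSpace ℝ (Fin 3)} {c : ℝ}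
    (hv : AEStronglyMeasurable (uncurry v)
      (volume.restrict (parabolicCylinder (1 / 2) (0 : ℝ × EuclideanSpace ℝ (Fin 3)))))
    (hσ : ∀ᵐ z ∂(volume.restrict (parabolicCylinder (1 / 2) (0 : ℝ × EuclideanSpace ℝ (Fin 3)))),
      |swirl (v z.1) z.2| ≤ c)
    {lam : ℕ → ℝ} (hlam : ∀ j, 0 < lam j) (hlam0 : Tendsto lam atTop (𝓝 0))
    {w : ℝ → EuclideanSpace ℝ (Fin 3) → EuclideanSpace ℝ (Fin 3)} {a : ℝ} (ha : 0 < a)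
    (hw : AEStronglyMeasurable (uncurry w)
      (volume.restrict (parabolicCylinder a (0 : ℝ × EuclideanSpace ℝ (Fin 3)))))
    (hconv : Tendsto (fun j => eLpNorm
        (uncurry ((lam j) • stPull ((lam j) ^ 2) (lam j) (0 : ℝ)
          (0 : EuclideanSpace ℝ (Fin 3)) v) - uncurry w) 3
        (volume.restrict (parabolicCylinder a (0 : ℝ × EuclideanSpace ℝ (Fin 3)))))
      atTop (𝓝 0)) :
    ∀ᵐ z ∂(volume.restrict (parabolicCylinder a (0 : ℝ × EuclideanSpace ℝ (Fin 3)))),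
      |swirl (w z.1) z.2| ≤ c := by
  -- indices with `λⱼ a ≤ 1/2`
  have hev : ∀ᶠ j in atTop, a * lam j ≤ 1 / 2 := by
    have h := hlam0.const_mul a
    rw [mul_zero] at h
    exact (h.eventually (ge_mem_nhds (by norm_num : (0 : ℝ) < 1 / 2))).mono fun j hj => hj
  obtain ⟨j₀, hj₀⟩ := eventually_atTop.1 hev
  have hj₀' : ∀ j, a * lam (j + j₀) ≤ 1 / 2 := fun j => hj₀ (j + j₀) (Nat.le_add_left _ _)
  -- the shifted sequence is measurable on `Q(a)` and still converges
  have hv0 : AEStronglyMeasurable (uncurry v) (volume.restrict (parabolicCylinder (1 / 2)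
      (((0 : ℝ), (0 : EuclideanSpace ℝ (Fin 3))) : ℝ × EuclideanSpace ℝ (Fin 3)))) := hv
  have hV : ∀ j, AEStronglyMeasurable
      (uncurry ((lam (j + j₀)) • stPull ((lam (j + j₀)) ^ 2) (lam (j + j₀)) (0 : ℝ)
        (0 : EuclideanSpace ℝ (Fin 3)) v))
      (volume.restrict (parabolicCylinder a (0 : ℝ × EuclideanSpace ℝ (Fin 3)))) := fun j =>
    aestronglyMeasurable_uncurry_zoom_of hv0 (hlam _) ha (hj₀' j)
  have hconv' := (tendsto_add_atTop_iff_nat (f := fun j => eLpNorm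
      (uncurry ((lam j) • stPull ((lam j) ^ 2) (lam j) (0 : ℝ) (0 : EuclideanSpace ℝ (Fin 3)) v) -
        uncurry w) 3
      (volume.restrict (parabolicCylinder a (0 : ℝ × EuclideanSpace ℝ (Fin 3))))) j₀).2 hconv
  refine ae_abs_swirl_le_of_tendsto_eLpNorm hV hw hconv' (Eventually.of_forall fun j => ?_)
  exact ae_abs_swirl_zoom_le hσ (hlam _) ha (hj₀' j)

/-- **Seregin 2020, proof of Thm 2.1: the blow-up limit with properties (𝒜), (2.8) and (2.9).**
Under the hypotheses of Theorem 2.1, the Type I assumption `g(0) < ∞`, AND the swirl bound (2.6)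
for the original solution in the a.e. form `|swirl (u t) x| ≤ c` on `Q(1/2)` (hypothesis `hσ`;
in print the output of the Moser iteration (2.2)–(2.6)), the blow-up limit `(w, π)` of
`exists_ancientLimit_isAxisymmetric` — pointwise axisymmetric, suitable in every `Q(a)` with
`A, C, D, A + E ≤ K`, `C ≥ κ > 0`, singular at the origin, strong/weak limit of the rescaled pairs —
has moreover a bounded swirl: `|swirl (w s) y| ≤ c` for a.e. `(s, y) ∈ Q(a)`, every `a > 0`
((2.8): `Γ = ϱ u_φ ∈ L_∞(Q₋)`). [cite: Seregin2020, proof of Thm 2.1, properties (𝒜), (2.8), (2.9)] -/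
theorem exists_ancientLimit_isAxisymmetric_swirl_le
    {u : ℝ → EuclideanSpace ℝ (Fin 3) → EuclideanSpace ℝ (Fin 3)}
    {p : ℝ → EuclideanSpace ℝ (Fin 3) → ℝ}
    {G : ℝ → EuclideanSpace ℝ (Fin 3) → EuclideanSpace ℝ (Fin 3) →L[ℝ] EuclideanSpace ℝ (Fin 3)}
    (hsw : IsSuitableWeakSolutionOn (SereginSverak2009.parCylOpens 0 1) 1 0 u p)
    (hA : ∃ C : ℝ≥0, ∀ᵐ t ∂(volume.restrict (Ioo (-1 : ℝ) 0)),
      ∫⁻ x in SereginSverak2009.spaceCyl 0 1, ‖u t x‖ₑ ^ 2 ≤ C)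
    (hG : HasWeakSpatialGradientOn (SereginSverak2009.parCylOpens 0 1) u G)
    (hE : ∫⁻ z in SereginSverak2009.parCyl 0 1, ENNReal.ofReal (frobeniusNormSq (G z.1 z.2)) < ∞)
    (hp : ∫⁻ z in SereginSverak2009.parCyl 0 1, ‖p z.1 z.2‖ₑ ^ (3 / 2 : ℝ) < ∞)
    (hu_ax : ∀ t ∈ Ioo (-1 : ℝ) 0, IsAxisymmetric (u t))
    (hp_ax : ∀ t ∈ Ioo (-1 : ℝ) 0, IsAxisymmetricScalar (p t))
    (hsing : IsBackwardSingularPoint u 0) (hI : blowupIndex 0 u G < ∞) {c : ℝ}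
    (hσ : ∀ᵐ z ∂(volume.restrict (parabolicCylinder (1 / 2) (0 : ℝ × EuclideanSpace ℝ (Fin 3)))),
      |swirl (u z.1) z.2| ≤ c) :
    ∃ (K : ℝ≥0) (κ : ℝ) (lam : ℕ → ℝ)
      (w : ℝ → EuclideanSpace ℝ (Fin 3) → EuclideanSpace ℝ (Fin 3))
      (π : ℝ → EuclideanSpace ℝ (Fin 3) → ℝ),
      0 < κ ∧ (∀ j, 0 < lam j) ∧ Tendsto lam atTop (𝓝 0) ∧
      IsBackwardSingularPoint w 0 ∧
      (∀ s, IsAxisymmetric (w s)) ∧ (∀ s, IsAxisymmetricScalar (π s)) ∧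
      ∀ a : ℝ, 0 < a →
        IsSuitableWeakSolutionInBall a 0 w π ∧
        MemLp (uncurry w) 3
          (volume.restrict (parabolicCylinder a (0 : ℝ × EuclideanSpace ℝ (Fin 3)))) ∧
        Tendsto (fun j => eLpNorm
            (uncurry ((lam j) • stPull ((lam j) ^ 2) (lam j) (0 : ℝ)
              (0 : EuclideanSpace ℝ (Fin 3)) u) - uncurry w) 3
            (volume.restrict (parabolicCylinder a (0 : ℝ × EuclideanSpace ℝ (Fin 3)))))
          atTop (𝓝 0) ∧
        (∀ g : ℝ × EuclideanSpace ℝ (Fin 3) → ℝ,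
          MemLp g 3 (volume.restrict (parabolicCylinder a (0 : ℝ × EuclideanSpace ℝ (Fin 3)))) →
          Tendsto (fun j => ∫ w' in parabolicCylinder a (0 : ℝ × EuclideanSpace ℝ (Fin 3)),
              ((lam j) ^ 2 • stPull ((lam j) ^ 2) (lam j) (0 : ℝ)
                (0 : EuclideanSpace ℝ (Fin 3)) p) w'.1 w'.2 * g w')
            atTop (𝓝 (∫ w' in parabolicCylinder a (0 : ℝ × EuclideanSpace ℝ (Fin 3)),
              π w'.1 w'.2 * g w'))) ∧
        cknAEss a (0 : ℝ × EuclideanSpace ℝ (Fin 3)) w ≤ K ∧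
        cknC a (0 : ℝ × EuclideanSpace ℝ (Fin 3)) w ≤ K ∧
        cknD a (0 : ℝ × EuclideanSpace ℝ (Fin 3)) π ≤ K ∧
        (∃ G' : ℝ → EuclideanSpace ℝ (Fin 3) → EuclideanSpace ℝ (Fin 3) →L[ℝ] EuclideanSpace ℝ (Fin 3),
          HasWeakSpatialGradientOn
              (parabolicCylinderOpens (2 * a) (0 : ℝ × EuclideanSpace ℝ (Fin 3))) w G' ∧
            cknAEss a (0 : ℝ × EuclideanSpace ℝ (Fin 3)) w +
              cknE a (0 : ℝ × EuclideanSpace ℝ (Fin 3)) G' ≤ K) ∧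
        ENNReal.ofReal κ ≤ cknC a (0 : ℝ × EuclideanSpace ℝ (Fin 3)) w ∧
        ∀ᵐ z ∂(volume.restrict (parabolicCylinder a (0 : ℝ × EuclideanSpace ℝ (Fin 3)))),
          |swirl (w z.1) z.2| ≤ c := by
  obtain ⟨K, κ, lam, w, π, hκ, hlam, hlam0, hsingw, hwax, hπax, hall⟩ :=
    exists_ancientLimit_isAxisymmetric hsw hA hG hE hp hu_ax hp_ax hsing hI
  -- measurability of `u` on `Q(1/2) ⊆ Q`
  have hQ : parabolicCylinder (1 / 2) (0 : ℝ × EuclideanSpace ℝ (Fin 3)) ⊆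
      ((SereginSverak2009.parCylOpens 0 1 : Opens (ℝ × EuclideanSpace ℝ (Fin 3))) :
        Set (ℝ × EuclideanSpace ℝ (Fin 3))) := by
    rw [SereginSverak2009.coe_parCylOpens]
    exact (parabolicCylinder_mono (by norm_num) (by norm_num : (1 : ℝ) / 2 ≤ 1) _).trans
      (parabolicCylinder_subset_parCyl 0 1)
  have hu_meas : AEStronglyMeasurable (uncurry u)
      (volume.restrict (parabolicCylinder (1 / 2) (0 : ℝ × EuclideanSpace ℝ (Fin 3)))) :=
    hG.locallyIntegrableOn.aestronglyMeasurable.mono_measure (Measure.restrict_mono hQ le_rfl)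
  refine ⟨K, κ, lam, w, π, hκ, hlam, hlam0, hsingw, hwax, hπax, fun a ha => ?_⟩
  obtain ⟨h1, h2, h3, h4, h5, h6, h7, h8, h9⟩ := hall a ha
  exact ⟨h1, h2, h3, h4, h5, h6, h7, h8, h9,
    ancientLimit_abs_swirl_le hu_meas hσ hlam hlam0 ha h2.1 h3⟩

/-! ### The registered sub-stub -/

/-- **Sub-stub `stub_seregin2020TypeII_limitSwirlBound` of the crux `AxisymmetricKatoGlobal`**
(toward `stub_seregin2020TypeII`, Seregin 2020 Thm 2.1, (2.8) from (2.6)):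
`ancientLimit_abs_swirl_le` and `exists_ancientLimit_isAxisymmetric_swirl_le`, conjoined.
[cite: Seregin2020, proof of Thm 2.1, (2.6) and (2.8)] -/
theorem stub_seregin2020TypeII_limitSwirlBound :
    (∀ (v : ℝ → EuclideanSpace ℝ (Fin 3) → EuclideanSpace ℝ (Fin 3)) (c : ℝ),
      AEStronglyMeasurable (uncurry v)
        (volume.restrict (parabolicCylinder (1 / 2) (0 : ℝ × EuclideanSpace ℝ (Fin 3)))) →
      (∀ᵐ z ∂(volume.restrict (parabolicCylinder (1 / 2) (0 : ℝ × EuclideanSpace ℝ (Fin 3)))),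
        |swirl (v z.1) z.2| ≤ c) →
      ∀ (lam : ℕ → ℝ), (∀ j, 0 < lam j) → Tendsto lam atTop (𝓝 0) →
      ∀ (w : ℝ → EuclideanSpace ℝ (Fin 3) → EuclideanSpace ℝ (Fin 3)) (a : ℝ), 0 < a →
      AEStronglyMeasurable (uncurry w)
        (volume.restrict (parabolicCylinder a (0 : ℝ × EuclideanSpace ℝ (Fin 3)))) →
      Tendsto (fun j => eLpNorm
          (uncurry ((lam j) • stPull ((lam j) ^ 2) (lam j) (0 : ℝ)
            (0 : EuclideanSpace ℝ (Fin 3)) v) - uncurry w) 3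
          (volume.restrict (parabolicCylinder a (0 : ℝ × EuclideanSpace ℝ (Fin 3)))))
        atTop (𝓝 0) →
      ∀ᵐ z ∂(volume.restrict (parabolicCylinder a (0 : ℝ × EuclideanSpace ℝ (Fin 3)))),
        |swirl (w z.1) z.2| ≤ c) ∧
    (∀ (u : ℝ → EuclideanSpace ℝ (Fin 3) → EuclideanSpace ℝ (Fin 3))
      (p : ℝ → EuclideanSpace ℝ (Fin 3) → ℝ)
      (G : ℝ → EuclideanSpace ℝ (Fin 3) → EuclideanSpace ℝ (Fin 3) →L[ℝ] EuclideanSpace ℝ (Fin 3)) (c : ℝ),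
      IsSuitableWeakSolutionOn (SereginSverak2009.parCylOpens 0 1) 1 0 u p →
      (∃ C : ℝ≥0, ∀ᵐ t ∂(volume.restrict (Ioo (-1 : ℝ) 0)),
        ∫⁻ x in SereginSverak2009.spaceCyl 0 1, ‖u t x‖ₑ ^ 2 ≤ C) →
      HasWeakSpatialGradientOn (SereginSverak2009.parCylOpens 0 1) u G →
      (∫⁻ z in SereginSverak2009.parCyl 0 1, ENNReal.ofReal (frobeniusNormSq (G z.1 z.2)) < ∞) →
      (∫⁻ z in SereginSverak2009.parCyl 0 1, ‖p z.1 z.2‖ₑ ^ (3 / 2 : ℝ) < ∞) →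
      (∀ t ∈ Ioo (-1 : ℝ) 0, IsAxisymmetric (u t)) →
      (∀ t ∈ Ioo (-1 : ℝ) 0, IsAxisymmetricScalar (p t)) →
      IsBackwardSingularPoint u 0 → Seregin2020.blowupIndex 0 u G < ∞ →
      (∀ᵐ z ∂(volume.restrict (parabolicCylinder (1 / 2) (0 : ℝ × EuclideanSpace ℝ (Fin 3)))),
        |swirl (u z.1) z.2| ≤ c) →
      ∃ (K : ℝ≥0) (κ : ℝ) (lam : ℕ → ℝ)
        (w : ℝ → EuclideanSpace ℝ (Fin 3) → EuclideanSpace ℝ (Fin 3))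
        (π : ℝ → EuclideanSpace ℝ (Fin 3) → ℝ),
        0 < κ ∧ (∀ j, 0 < lam j) ∧ Tendsto lam atTop (𝓝 0) ∧
        IsBackwardSingularPoint w 0 ∧
        (∀ s, IsAxisymmetric (w s)) ∧ (∀ s, IsAxisymmetricScalar (π s)) ∧
        ∀ a : ℝ, 0 < a →
          IsSuitableWeakSolutionInBall a 0 w π ∧
          MemLp (uncurry w) 3
            (volume.restrict (parabolicCylinder a (0 : ℝ × EuclideanSpace ℝ (Fin 3)))) ∧
          Tendsto (fun j => eLpNorm
              (uncurry ((lam j) • stPull ((lam j) ^ 2) (lam j) (0 : ℝ)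
                (0 : EuclideanSpace ℝ (Fin 3)) u) - uncurry w) 3
              (volume.restrict (parabolicCylinder a (0 : ℝ × EuclideanSpace ℝ (Fin 3)))))
            atTop (𝓝 0) ∧
          (∀ g : ℝ × EuclideanSpace ℝ (Fin 3) → ℝ,
            MemLp g 3 (volume.restrict (parabolicCylinder a (0 : ℝ × EuclideanSpace ℝ (Fin 3)))) →
            Tendsto (fun j => ∫ w' in parabolicCylinder a (0 : ℝ × EuclideanSpace ℝ (Fin 3)),
                ((lam j) ^ 2 • stPull ((lam j) ^ 2) (lam j) (0 : ℝ)
                  (0 : EuclideanSpace ℝ (Fin 3)) p) w'.1 w'.2 * g w')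
              atTop (𝓝 (∫ w' in parabolicCylinder a (0 : ℝ × EuclideanSpace ℝ (Fin 3)),
                π w'.1 w'.2 * g w'))) ∧
          cknAEss a (0 : ℝ × EuclideanSpace ℝ (Fin 3)) w ≤ K ∧
          cknC a (0 : ℝ × EuclideanSpace ℝ (Fin 3)) w ≤ K ∧
          cknD a (0 : ℝ × EuclideanSpace ℝ (Fin 3)) π ≤ K ∧
          (∃ G' : ℝ → EuclideanSpace ℝ (Fin 3) → EuclideanSpace ℝ (Fin 3) →L[ℝ] EuclideanSpace ℝ (Fin 3),
            HasWeakSpatialGradientOn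
                (parabolicCylinderOpens (2 * a) (0 : ℝ × EuclideanSpace ℝ (Fin 3))) w G' ∧
              cknAEss a (0 : ℝ × EuclideanSpace ℝ (Fin 3)) w +
                cknE a (0 : ℝ × EuclideanSpace ℝ (Fin 3)) G' ≤ K) ∧
          ENNReal.ofReal κ ≤ cknC a (0 : ℝ × EuclideanSpace ℝ (Fin 3)) w ∧
          ∀ᵐ z ∂(volume.restrict (parabolicCylinder a (0 : ℝ × EuclideanSpace ℝ (Fin 3)))),
            |swirl (w z.1) z.2| ≤ c) :=
  ⟨fun _ _ hv hσ _ hlam hlam0 _ _ ha hw hconv => ancientLimit_abs_swirl_le hv hσ hlam hlam0 ha hw hconv,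
    fun _ _ _ _ hsw hA hG hE hp hu_ax hp_ax hsing hI hσ =>
      exists_ancientLimit_isAxisymmetric_swirl_le hsw hA hG hE hp hu_ax hp_ax hsing hI hσ⟩

end Summit.NavierStokesRegularity.NavierStokesRegularity.Theorems.AxisymmetricKatoGlobal.EulerScaling

end
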